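import Literature.NumberTheory.Automorphic.UnitaryGroupLineConjOneFactorTwo
import Literature.NumberTheory.Automorphic.UnitaryGroupHeisenbergConjLevelDilated
import HarnessLib

/-!
# The dilated line domain `β⁻¹ n(𝓕⁻) β` of `N(𝔸_F) ≅ 𝔸_E⁻` in `U(J₂)`: a fundamental domain for `N(F)`,
# and the level condition on it (the `N = 2` sibling of ★ `UnitaryGroupHeisenbergConjFundamentalDomain` §1/§4
# and of ★ `UnitaryGroupHeisenbergConjLevelDilated` §2–§3)
(Rogawski, *Automorphic Representations of Unitary Groups in Three Variables* (1990), §1.10, §2.1, §2.2 (p. 13);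
Cassels–Fröhlich, *Algebraic Number Theory* (1967), Ch. XV Thm. 4.1.3)

Topic `NumberTheory/Automorphic`; namespace `Literature.NumberTheory.Automorphic.UnitaryGroup`. THEOREMS ONLY
(kernel lane: no definition, no named fact, no instance, no notation, no `sorry`). H-side LAW 1 at `N = 2` (the
Siegel-domain integrability of Arthur's truncated kernel on `H = U(Φ₂) × U(Φ₁)`), row (R6b-i) of B-p14 (g26)'s
list: the fundamental domain `𝓕₀` of the `N = 2` ROW PACKAGE (★ `truncatedKernelClassIntegrable_of_rows_two`,
clause `IsFundamentalDomain (rationalUnipotent F E c 2) 𝓕₀ ν ∧ IsCompact W₀ ∧ 𝓕₀ ⊆ W₀`) is the DILATE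
`𝓕₀ = β⁻¹ n(𝓕⁻) β` of B-p04's transported Tate domain `n(𝓕⁻)` (★ `UnitaryGroupLineUnipotentTwo`:
`n = middleRootUnipotent`, `𝓕⁻ = traceZeroFundamentalDomain F E c ⊆ 𝔸_E⁻`) by a RATIONAL Borel element `β`
(in the application the diagonal `diag(m⁻¹, m)`, `m ∈ ℕ`, of ★ `exists_rational_torus_two`).

* §1 `β⁻¹ n(𝓕⁻) β` IS A FUNDAMENTAL DOMAIN: `conj_rational_mem_rationalUnipotent_two`, `mem_borelConj_image_iff_two`,
  `existsUnique_smul_mem_borelConj_image_two` (transport of ★ `existsUnique_smul_mem_image_traceZeroFundamentalDomain_two`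
  along `u ↦ β⁻¹ u β`, which maps `N(F)` onto itself), `exists_isCompact_borelConj_lineDomain_subset_two`,
  `measurableSet_borelConj_image_two`, **`isFundamentalDomain_borelConj_image_two`** (every measure).
* §2 THE LEVEL CONDITION ON `β⁻¹ n(𝓕⁻) β`: the only off-diagonal entries of `π(b⁻¹ u b)` are `(0,1) ↦ d₀⁻¹d₁(b) ·
  d₀⁻¹d₁(β) · y₀` (`u = β⁻¹ n(y₀) β`, `y₀ ∈ 𝓕⁻`, ★ `coe_middleCoord_borelConj_two`) and `(1,0) ↦ 0`, and `|y₀|_v ≤ |½|_v`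
  (★ `valued_coe_snd_le_of_mem_traceZeroFundamentalDomain`); hence ONE inequality per finite place,
  `|d₀⁻¹d₁(β)|_v · |d₀⁻¹d₁(b)|_v · |½|_v ≤ |𝔩|_v`, for `𝔩 = 𝔫` and for `𝔩 = c⁻¹ • 𝔫`, gives the `hval` premise of ★
  `exists_isCompact_forall_oneFactor_two` (`forall_valued_entry_le_of_mem_borelConj_image_two`,
  **`hval_of_mem_borelConj_image_two`**; the conjugate condition at `v` for `𝔫` is the plain one at `c⁻¹ v` for
  `c⁻¹ • 𝔫`, ★ `valued_galAdicCompletionMap`, ★ `idealRadius_smul`).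
* §3 **`exists_isCompact_forall_oneFactor_dilated_two`** — the ONE-FACTOR NORMAL FORM ON `β⁻¹ n(𝓕⁻) β` (★
  `exists_isCompact_forall_oneFactor_two` at the compact superset of §1, fed by §2): the geometry clause of the row
  package modulo the two inequalities, which ★ `UnitaryGroupSiegelConjLevelDepthTwo` (R6b-ii) supplies on the
  Siegel set.

## References
* J. D. Rogawski, *Automorphic Representations of Unitary Groups in Three Variables*, Ann. of Math. Stud. 123
  (1990), §1.10, §2.1, §2.2 (p. 13) [Rogawski1990].
* J. W. S. Cassels, A. Fröhlich (eds.), *Algebraic Number Theory* (1967), Ch. VII §1.1, Ch. XV Thm. 4.1.3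
  [CasselsFrohlichANT1967].
* J. R. Getz, H. Hahn, *An Introduction to Automorphic Representations*, GTM 300 (2024), §2.7, §3.5 [GetzHahn2024].
-/

set_option autoImplicit false

noncomputable section

open Matrix NumberField NumberField.mixedEmbedding IsDedekindDomain Topology MeasureTheory Set
-- `open scoped Classical` is needed to see the Mathlib normed-ring instances on `mixedSpace E` (note H5 of `AdelicGLnGlue`)
open scoped MatrixGroups Classical Pointwise

namespace Literature.NumberTheory.Automorphic

namespace UnitaryGroup

variable {F E : Type} [Field F] [NumberField F] [Field E] [NumberField E] [Algebra F E]
  {c : E ≃ₐ[F] E}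
  (hij : (((0 : Fin 2) : Fin 2) : ℕ) + 1 = (((1 : Fin 2) : Fin 2) : ℕ)) (hN : 2 = 2 * (((0 : Fin 2) : Fin 2) : ℕ) + 2)

/-! ## §1 `β⁻¹ n(𝓕⁻) β` is a fundamental domain for a rational `β ∈ B(𝔸_F)` -/

/-- `β⁻¹ γ β ∈ N(F)` for `β ∈ B(𝔸_F)` rational and `γ ∈ N(F)` (both lie in the arithmetic subgroup, and `B`
normalises `N`, ★ `conj_mem_adelicUnipotent`). [cite: Rogawski1990, §1.10] -/
theorem conj_rational_mem_rationalUnipotent_two (β : borelAdelic F E c 2)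
    (hβ : (β : (quasiSplit F E c 2).Adelic) ∈ (quasiSplit F E c 2).arithmeticSubgroup)
    (γ : ↥(rationalUnipotent F E c 2)) :
    (⟨(β : (quasiSplit F E c 2).Adelic)⁻¹ * ((γ : ↥(adelicUnipotent F E c 2)) : (quasiSplit F E c 2).Adelic) *
        (β : (quasiSplit F E c 2).Adelic), conj_mem_adelicUnipotent β.2 (γ : ↥(adelicUnipotent F E c 2)).2⟩ :
      ↥(adelicUnipotent F E c 2)) ∈ rationalUnipotent F E c 2 := by
  change (β : (quasiSplit F E c 2).Adelic)⁻¹ * ((γ : ↥(adelicUnipotent F E c 2)) : (quasiSplit F E c 2).Adelic) *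
      (β : (quasiSplit F E c 2).Adelic) ∈ (quasiSplit F E c 2).arithmeticSubgroup
  exact Subgroup.mul_mem _ (Subgroup.mul_mem _ (Subgroup.inv_mem _ hβ) γ.2) hβ

/-- **Membership in `β⁻¹ S β`**: `w ∈ φ_β '' S ↔ β w β⁻¹ ∈ S`, for any `S ⊆ N(𝔸_F)`. [cite: Rogawski1990, §2.1] -/
theorem mem_borelConj_image_iff_two (β : borelAdelic F E c 2) (S : Set ↥(adelicUnipotent F E c 2))
    (w : ↥(adelicUnipotent F E c 2)) :
    w ∈ (fun v : ↥(adelicUnipotent F E c 2) => (⟨(β : (quasiSplit F E c 2).Adelic)⁻¹ * (v : (quasiSplit F E c 2).Adelic) *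
        (β : (quasiSplit F E c 2).Adelic), conj_mem_adelicUnipotent β.2 v.2⟩ : ↥(adelicUnipotent F E c 2))) '' S ↔
      (⟨((β⁻¹ : borelAdelic F E c 2) : (quasiSplit F E c 2).Adelic)⁻¹ * (w : (quasiSplit F E c 2).Adelic) *
          ((β⁻¹ : borelAdelic F E c 2) : (quasiSplit F E c 2).Adelic), conj_mem_adelicUnipotent (β⁻¹).2 w.2⟩ :
        ↥(adelicUnipotent F E c 2)) ∈ S := by
  constructor
  · rintro ⟨v, hv, rfl⟩
    convert hv using 1
    refine Subtype.ext ?_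
    change ((β⁻¹ : borelAdelic F E c 2) : (quasiSplit F E c 2).Adelic)⁻¹ *
      ((β : (quasiSplit F E c 2).Adelic)⁻¹ * (v : (quasiSplit F E c 2).Adelic) * (β : (quasiSplit F E c 2).Adelic)) *
        ((β⁻¹ : borelAdelic F E c 2) : (quasiSplit F E c 2).Adelic) = (v : (quasiSplit F E c 2).Adelic)
    simp only [Subgroup.coe_inv]
    group
  · intro hw
    refine ⟨_, hw, Subtype.ext ?_⟩
    change (β : (quasiSplit F E c 2).Adelic)⁻¹ *
      (((β⁻¹ : borelAdelic F E c 2) : (quasiSplit F E c 2).Adelic)⁻¹ * (w : (quasiSplit F E c 2).Adelic) *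
        ((β⁻¹ : borelAdelic F E c 2) : (quasiSplit F E c 2).Adelic)) * (β : (quasiSplit F E c 2).Adelic) =
      (w : (quasiSplit F E c 2).Adelic)
    simp only [Subgroup.coe_inv]
    group

/-- **Unique representability in `β⁻¹ n(𝓕⁻) β`**: for `β ∈ B(𝔸_F)` rational, every `u ∈ N(𝔸_F)` has exactly one left
`N(F)`-translate in `φ_β '' n(𝓕⁻)` (transport of ★ `existsUnique_smul_mem_image_traceZeroFundamentalDomain_two` along
`φ_β`, which maps `N(F)` onto itself). [cite: CasselsFrohlichANT1967, Ch. XV Thm. 4.1.3 (1)] [cite: Rogawski1990, §2.1] -/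
theorem existsUnique_smul_mem_borelConj_image_two (hc : c * c = 1) (β : borelAdelic F E c 2)
    (hβ : (β : (quasiSplit F E c 2).Adelic) ∈ (quasiSplit F E c 2).arithmeticSubgroup) (u : ↥(adelicUnipotent F E c 2)) :
    ∃! γ : ↥(rationalUnipotent F E c 2), γ • u ∈
      (fun v : ↥(adelicUnipotent F E c 2) => (⟨(β : (quasiSplit F E c 2).Adelic)⁻¹ * (v : (quasiSplit F E c 2).Adelic) *
        (β : (quasiSplit F E c 2).Adelic), conj_mem_adelicUnipotent β.2 v.2⟩ : ↥(adelicUnipotent F E c 2))) ''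
        ((fun y : ↥(traceZeroAdele F E c) => middleRootUnipotent hij hN (Multiplicative.ofAdd y)) ''
          traceZeroFundamentalDomain F E c) := by
  -- `ψ u = β u β⁻¹`
  set ψu : ↥(adelicUnipotent F E c 2) := ⟨((β⁻¹ : borelAdelic F E c 2) : (quasiSplit F E c 2).Adelic)⁻¹ *
      (u : (quasiSplit F E c 2).Adelic) * ((β⁻¹ : borelAdelic F E c 2) : (quasiSplit F E c 2).Adelic),
    conj_mem_adelicUnipotent (β⁻¹).2 u.2⟩ with hψu
  obtain ⟨γ₁, hγ₁, huniq⟩ := existsUnique_smul_mem_image_traceZeroFundamentalDomain_two hij hN hc ψu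
  have hβ' : ((β⁻¹ : borelAdelic F E c 2) : (quasiSplit F E c 2).Adelic) ∈ (quasiSplit F E c 2).arithmeticSubgroup := by
    rw [Subgroup.coe_inv]; exact Subgroup.inv_mem _ hβ
  refine ⟨⟨_, conj_rational_mem_rationalUnipotent_two β hβ γ₁⟩, ?_, ?_⟩
  · -- existence: `(β⁻¹ γ₁ β) • u ∈ φ_β '' n(𝓕⁻)` since `β ((β⁻¹γ₁β) u) β⁻¹ = γ₁ (β u β⁻¹) ∈ n(𝓕⁻)`
    beta_reduce
    rw [mem_borelConj_image_iff_two β]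
    convert hγ₁ using 1
    refine Subtype.ext ?_
    rw [Subgroup.smul_def, smul_eq_mul, Subgroup.smul_def, smul_eq_mul]
    change ((β⁻¹ : borelAdelic F E c 2) : (quasiSplit F E c 2).Adelic)⁻¹ *
      (((β : (quasiSplit F E c 2).Adelic)⁻¹ * ((γ₁ : ↥(adelicUnipotent F E c 2)) : (quasiSplit F E c 2).Adelic) *
          (β : (quasiSplit F E c 2).Adelic)) * (u : (quasiSplit F E c 2).Adelic)) *
        ((β⁻¹ : borelAdelic F E c 2) : (quasiSplit F E c 2).Adelic) =
      ((γ₁ : ↥(adelicUnipotent F E c 2)) : (quasiSplit F E c 2).Adelic) *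
        (((β⁻¹ : borelAdelic F E c 2) : (quasiSplit F E c 2).Adelic)⁻¹ * (u : (quasiSplit F E c 2).Adelic) *
          ((β⁻¹ : borelAdelic F E c 2) : (quasiSplit F E c 2).Adelic))
    simp only [Subgroup.coe_inv]
    group
  · -- uniqueness: `γ • u ∈ φ_β '' n(𝓕⁻)` ⇒ `(β γ β⁻¹) • ψ u ∈ n(𝓕⁻)` ⇒ `β γ β⁻¹ = γ₁`
    intro γ hγ
    rw [mem_borelConj_image_iff_two β] at hγ
    have hmem : (⟨_, conj_rational_mem_rationalUnipotent_two β⁻¹ hβ' γ⟩ : ↥(rationalUnipotent F E c 2)) • ψu ∈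
        (fun y : ↥(traceZeroAdele F E c) => middleRootUnipotent hij hN (Multiplicative.ofAdd y)) ''
          traceZeroFundamentalDomain F E c := by
      convert hγ using 1
      refine Subtype.ext ?_
      rw [Subgroup.smul_def, smul_eq_mul, Subgroup.smul_def, smul_eq_mul]
      change (((β⁻¹ : borelAdelic F E c 2) : (quasiSplit F E c 2).Adelic)⁻¹ *
            ((γ : ↥(adelicUnipotent F E c 2)) : (quasiSplit F E c 2).Adelic) *
          ((β⁻¹ : borelAdelic F E c 2) : (quasiSplit F E c 2).Adelic)) *
        (((β⁻¹ : borelAdelic F E c 2) : (quasiSplit F E c 2).Adelic)⁻¹ * (u : (quasiSplit F E c 2).Adelic) *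
          ((β⁻¹ : borelAdelic F E c 2) : (quasiSplit F E c 2).Adelic)) =
        ((β⁻¹ : borelAdelic F E c 2) : (quasiSplit F E c 2).Adelic)⁻¹ *
          (((γ : ↥(adelicUnipotent F E c 2)) : (quasiSplit F E c 2).Adelic) * (u : (quasiSplit F E c 2).Adelic)) *
            ((β⁻¹ : borelAdelic F E c 2) : (quasiSplit F E c 2).Adelic)
      simp only [Subgroup.coe_inv]
      group
    have hγ₁eq := huniq _ hmem
    -- `γ = β⁻¹ (β γ β⁻¹) β`
    refine Subtype.ext (Subtype.ext ?_)
    change ((γ : ↥(adelicUnipotent F E c 2)) : (quasiSplit F E c 2).Adelic) =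
      (β : (quasiSplit F E c 2).Adelic)⁻¹ * ((γ₁ : ↥(adelicUnipotent F E c 2)) : (quasiSplit F E c 2).Adelic) *
        (β : (quasiSplit F E c 2).Adelic)
    rw [← hγ₁eq]
    change ((γ : ↥(adelicUnipotent F E c 2)) : (quasiSplit F E c 2).Adelic) =
      (β : (quasiSplit F E c 2).Adelic)⁻¹ *
        (((β⁻¹ : borelAdelic F E c 2) : (quasiSplit F E c 2).Adelic)⁻¹ *
            ((γ : ↥(adelicUnipotent F E c 2)) : (quasiSplit F E c 2).Adelic) *
          ((β⁻¹ : borelAdelic F E c 2) : (quasiSplit F E c 2).Adelic)) * (β : (quasiSplit F E c 2).Adelic)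
    simp only [Subgroup.coe_inv]
    group

/-- `β⁻¹ n(𝓕⁻) β` is contained in a compact set (continuous image of ★
`exists_isCompact_image_traceZeroFundamentalDomain_subset_two`). [cite: CasselsFrohlichANT1967, Ch. XV Thm. 4.1.3 (2)] -/
theorem exists_isCompact_borelConj_lineDomain_subset_two (hc : c * c = 1) (β : borelAdelic F E c 2) :
    ∃ K : Set ↥(adelicUnipotent F E c 2), IsCompact K ∧
      (fun v : ↥(adelicUnipotent F E c 2) => (⟨(β : (quasiSplit F E c 2).Adelic)⁻¹ * (v : (quasiSplit F E c 2).Adelic) *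
        (β : (quasiSplit F E c 2).Adelic), conj_mem_adelicUnipotent β.2 v.2⟩ : ↥(adelicUnipotent F E c 2))) ''
        ((fun y : ↥(traceZeroAdele F E c) => middleRootUnipotent hij hN (Multiplicative.ofAdd y)) ''
          traceZeroFundamentalDomain F E c) ⊆ K := by
  obtain ⟨K, hK, hsub⟩ := exists_isCompact_image_traceZeroFundamentalDomain_subset_two (F := F) (E := E) (c := c) hij hN hc
  have hcont : Continuous (fun v : ↥(adelicUnipotent F E c 2) =>
      (⟨(β : (quasiSplit F E c 2).Adelic)⁻¹ * (v : (quasiSplit F E c 2).Adelic) * (β : (quasiSplit F E c 2).Adelic),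
        conj_mem_adelicUnipotent β.2 v.2⟩ : ↥(adelicUnipotent F E c 2))) :=
    Continuous.subtype_mk ((continuous_const.mul continuous_subtype_val).mul continuous_const) _
  exact ⟨_, hK.image hcont, Set.image_mono hsub⟩

section Measure

variable [MeasurableSpace (AdeleRing (𝓞 E) E)] [BorelSpace (AdeleRing (𝓞 E) E)]
  [MeasurableSpace ↥(adelicUnipotent F E c 2)] [BorelSpace ↥(adelicUnipotent F E c 2)]

/-- `β⁻¹ n(𝓕⁻) β` is a Borel set (image of the Borel set ★ `measurableSet_image_traceZeroFundamentalDomain_two` under the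
homeomorphism `φ_β`). [cite: CasselsFrohlichANT1967, Ch. XV Thm. 4.1.3 (1)] -/
theorem measurableSet_borelConj_image_two (β : borelAdelic F E c 2) :
    MeasurableSet ((fun v : ↥(adelicUnipotent F E c 2) => (⟨(β : (quasiSplit F E c 2).Adelic)⁻¹ * (v : (quasiSplit F E c 2).Adelic) *
        (β : (quasiSplit F E c 2).Adelic), conj_mem_adelicUnipotent β.2 v.2⟩ : ↥(adelicUnipotent F E c 2))) ''
        ((fun y : ↥(traceZeroAdele F E c) => middleRootUnipotent hij hN (Multiplicative.ofAdd y)) ''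
          traceZeroFundamentalDomain F E c)) := by
  let e : ↥(adelicUnipotent F E c 2) ≃ₜ ↥(adelicUnipotent F E c 2) :=
    { toFun := fun v => ⟨(β : (quasiSplit F E c 2).Adelic)⁻¹ * (v : (quasiSplit F E c 2).Adelic) * (β : (quasiSplit F E c 2).Adelic),
        conj_mem_adelicUnipotent β.2 v.2⟩
      invFun := fun w => ⟨((β⁻¹ : borelAdelic F E c 2) : (quasiSplit F E c 2).Adelic)⁻¹ * (w : (quasiSplit F E c 2).Adelic) *
        ((β⁻¹ : borelAdelic F E c 2) : (quasiSplit F E c 2).Adelic), conj_mem_adelicUnipotent (β⁻¹).2 w.2⟩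
      left_inv := fun v => Subtype.ext (by
        change ((β⁻¹ : borelAdelic F E c 2) : (quasiSplit F E c 2).Adelic)⁻¹ *
          ((β : (quasiSplit F E c 2).Adelic)⁻¹ * (v : (quasiSplit F E c 2).Adelic) * (β : (quasiSplit F E c 2).Adelic)) *
            ((β⁻¹ : borelAdelic F E c 2) : (quasiSplit F E c 2).Adelic) = (v : (quasiSplit F E c 2).Adelic)
        simp only [Subgroup.coe_inv]
        group)
      right_inv := fun w => Subtype.ext (by
        change (β : (quasiSplit F E c 2).Adelic)⁻¹ *
          (((β⁻¹ : borelAdelic F E c 2) : (quasiSplit F E c 2).Adelic)⁻¹ * (w : (quasiSplit F E c 2).Adelic) *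
            ((β⁻¹ : borelAdelic F E c 2) : (quasiSplit F E c 2).Adelic)) * (β : (quasiSplit F E c 2).Adelic) =
          (w : (quasiSplit F E c 2).Adelic)
        simp only [Subgroup.coe_inv]
        group)
      continuous_toFun := Continuous.subtype_mk ((continuous_const.mul continuous_subtype_val).mul continuous_const) _
      continuous_invFun := Continuous.subtype_mk ((continuous_const.mul continuous_subtype_val).mul continuous_const) _ }
  have himage : (fun v : ↥(adelicUnipotent F E c 2) => (⟨(β : (quasiSplit F E c 2).Adelic)⁻¹ * (v : (quasiSplit F E c 2).Adelic) *
        (β : (quasiSplit F E c 2).Adelic), conj_mem_adelicUnipotent β.2 v.2⟩ : ↥(adelicUnipotent F E c 2))) ''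
        ((fun y : ↥(traceZeroAdele F E c) => middleRootUnipotent hij hN (Multiplicative.ofAdd y)) ''
          traceZeroFundamentalDomain F E c) =
      e.toMeasurableEquiv '' ((fun y : ↥(traceZeroAdele F E c) => middleRootUnipotent hij hN (Multiplicative.ofAdd y)) ''
          traceZeroFundamentalDomain F E c) := rfl
  rw [himage, MeasurableEquiv.measurableSet_image]
  exact measurableSet_image_traceZeroFundamentalDomain_two hij hN

/-- **`β⁻¹ n(𝓕⁻) β` is a measurable fundamental domain for `N(F)` acting on `N(𝔸_F)` by left translation, for every
measure** (`β ∈ B(𝔸_F)` rational; Mathlib `IsFundamentalDomain.mk'` from unique representability) — the `𝓕₀` of the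
`N = 2` row package. [cite: CasselsFrohlichANT1967, Ch. XV Thm. 4.1.3 (1)] [cite: Rogawski1990, §2.1] -/
theorem isFundamentalDomain_borelConj_image_two (hc : c * c = 1) (β : borelAdelic F E c 2)
    (hβ : (β : (quasiSplit F E c 2).Adelic) ∈ (quasiSplit F E c 2).arithmeticSubgroup) (μ : Measure ↥(adelicUnipotent F E c 2)) :
    IsFundamentalDomain ↥(rationalUnipotent F E c 2)
      ((fun v : ↥(adelicUnipotent F E c 2) => (⟨(β : (quasiSplit F E c 2).Adelic)⁻¹ * (v : (quasiSplit F E c 2).Adelic) *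
        (β : (quasiSplit F E c 2).Adelic), conj_mem_adelicUnipotent β.2 v.2⟩ : ↥(adelicUnipotent F E c 2))) ''
        ((fun y : ↥(traceZeroAdele F E c) => middleRootUnipotent hij hN (Multiplicative.ofAdd y)) ''
          traceZeroFundamentalDomain F E c)) μ :=
  IsFundamentalDomain.mk' (measurableSet_borelConj_image_two hij hN β).nullMeasurableSet
    (existsUnique_smul_mem_borelConj_image_two hij hN hc β hβ)

end Measure

/-! ## §2 The level condition on `β⁻¹ n(𝓕⁻) β`: one inequality per finite place -/

/-- The component of a product of adèles at a finite place (definitional). [folklore] -/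
private theorem snd_mul_apply' (x y : AdeleRing (𝓞 E) E) (v : HeightOneSpectrum (𝓞 E)) : (x * y).2 v = x.2 v * y.2 v := rfl

/-- **The off-diagonal entries of `π(b⁻¹ u b)` for `u ∈ β⁻¹ n(𝓕⁻) β` are `𝔫`-divisible** once
`|d₀⁻¹d₁(β)|_v · |d₀⁻¹d₁(b)|_v · |½|_v ≤ |𝔫|_v` at every finite place: the `(0,1)` entry is `d₀⁻¹d₁(b) · d₀⁻¹d₁(β) · y₀` with
`y₀ ∈ 𝓕⁻`, `|y₀|_v ≤ |½|_v` (★ `coe_middleCoord_borelConj_two`, ★ `valued_coe_snd_le_of_mem_traceZeroFundamentalDomain`), the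
`(1,0)` entry vanishes. [cite: Rogawski1990, §2.2 (p. 13)] -/
theorem forall_valued_entry_le_of_mem_borelConj_image_two (hc : c * c = 1) (β b : borelAdelic F E c 2) (𝔫 : Ideal (𝓞 E))
    (hval : ∀ v : HeightOneSpectrum (𝓞 E),
      Valued.v ((((((diagUnit β.2 0)⁻¹ * diagUnit β.2 1 : (AdeleRing (𝓞 E) E)ˣ)) : AdeleRing (𝓞 E) E)).2 v) *
        Valued.v ((((((diagUnit b.2 0)⁻¹ * diagUnit b.2 1 : (AdeleRing (𝓞 E) E)ˣ)) : AdeleRing (𝓞 E) E)).2 v) *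
          Valued.v ((halfAdele : AdeleRing (𝓞 E) E).2 v) ≤ idealRadius E v 𝔫)
    {u : ↥(adelicUnipotent F E c 2)}
    (hu : u ∈ (fun v : ↥(adelicUnipotent F E c 2) => (⟨(β : (quasiSplit F E c 2).Adelic)⁻¹ * (v : (quasiSplit F E c 2).Adelic) *
        (β : (quasiSplit F E c 2).Adelic), conj_mem_adelicUnipotent β.2 v.2⟩ : ↥(adelicUnipotent F E c 2))) ''
        ((fun y : ↥(traceZeroAdele F E c) => middleRootUnipotent hij hN (Multiplicative.ofAdd y)) ''
          traceZeroFundamentalDomain F E c)) :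
    ∀ i j : Fin 2, i ≠ j → ∀ v : HeightOneSpectrum (𝓞 E),
      Valued.v ((((adelicVal F E c 2 _ ((b : (quasiSplit F E c 2).Adelic)⁻¹ * (u : (quasiSplit F E c 2).Adelic) *
          (b : (quasiSplit F E c 2).Adelic)) : GL (Fin 2) (AdeleRing (𝓞 E) E)) : Matrix (Fin 2) (Fin 2) (AdeleRing (𝓞 E) E)) i j).2 v) ≤
        idealRadius E v 𝔫 := by
  obtain ⟨u₀, hu₀, rfl⟩ := hu
  rw [mem_image_traceZeroFundamentalDomain_iff_two hij hN] at hu₀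
  -- `w = b⁻¹ (β⁻¹ u₀ β) b ∈ N(𝔸_F)` and its line coordinate
  set u : ↥(adelicUnipotent F E c 2) := ⟨(β : (quasiSplit F E c 2).Adelic)⁻¹ * (u₀ : (quasiSplit F E c 2).Adelic) *
    (β : (quasiSplit F E c 2).Adelic), conj_mem_adelicUnipotent β.2 u₀.2⟩ with hu
  set w : ↥(adelicUnipotent F E c 2) := ⟨(b : (quasiSplit F E c 2).Adelic)⁻¹ * (u : (quasiSplit F E c 2).Adelic) *
    (b : (quasiSplit F E c 2).Adelic), conj_mem_adelicUnipotent b.2 u.2⟩ with hw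
  have hy : ((middleCoord hij hN w : ↥(traceZeroAdele F E c)) : AdeleRing (𝓞 E) E) =
      (((diagUnit b.2 0)⁻¹ * diagUnit b.2 1 : (AdeleRing (𝓞 E) E)ˣ) : AdeleRing (𝓞 E) E) *
        ((((diagUnit β.2 0)⁻¹ * diagUnit β.2 1 : (AdeleRing (𝓞 E) E)ˣ) : AdeleRing (𝓞 E) E) *
          ((middleCoord hij hN u₀ : ↥(traceZeroAdele F E c)) : AdeleRing (𝓞 E) E)) := by
    rw [hw, coe_middleCoord_borelConj_two b u, hu, coe_middleCoord_borelConj_two β u₀]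
  intro i j hne v
  change Valued.v ((((adelicVal F E c 2 _ (w : (quasiSplit F E c 2).Adelic) : GL (Fin 2) (AdeleRing (𝓞 E) E)) :
    Matrix (Fin 2) (Fin 2) (AdeleRing (𝓞 E) E)) i j).2 v) ≤ idealRadius E v 𝔫
  by_cases hlt : i < j
  · -- the `(0,1)` entry `= y(w)`
    obtain ⟨rfl, rfl⟩ : i = 0 ∧ j = 1 := by
      fin_cases i <;> fin_cases j <;> simp_all
    change Valued.v (((middleCoord hij hN w : ↥(traceZeroAdele F E c)) : AdeleRing (𝓞 E) E).2 v) ≤ idealRadius E v 𝔫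
    rw [hy]
    rw [snd_mul_apply', snd_mul_apply', map_mul, map_mul]
    have hy0 := valued_coe_snd_le_of_mem_traceZeroFundamentalDomain (F := F) hc hu₀ v
    calc Valued.v (((((diagUnit b.2 0)⁻¹ * diagUnit b.2 1 : (AdeleRing (𝓞 E) E)ˣ) : AdeleRing (𝓞 E) E)).2 v) *
          (Valued.v ((((((diagUnit β.2 0)⁻¹ * diagUnit β.2 1 : (AdeleRing (𝓞 E) E)ˣ) : AdeleRing (𝓞 E) E)).2 v)) *
            Valued.v ((((middleCoord hij hN u₀ : ↥(traceZeroAdele F E c)) : AdeleRing (𝓞 E) E)).2 v))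
        ≤ Valued.v (((((diagUnit b.2 0)⁻¹ * diagUnit b.2 1 : (AdeleRing (𝓞 E) E)ˣ) : AdeleRing (𝓞 E) E)).2 v) *
          (Valued.v ((((((diagUnit β.2 0)⁻¹ * diagUnit β.2 1 : (AdeleRing (𝓞 E) E)ˣ) : AdeleRing (𝓞 E) E)).2 v)) *
            Valued.v ((halfAdele : AdeleRing (𝓞 E) E).2 v)) := mul_le_mul' le_rfl (mul_le_mul' le_rfl hy0)
      _ = Valued.v ((((((diagUnit β.2 0)⁻¹ * diagUnit β.2 1 : (AdeleRing (𝓞 E) E)ˣ)) : AdeleRing (𝓞 E) E)).2 v) *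
            Valued.v ((((((diagUnit b.2 0)⁻¹ * diagUnit b.2 1 : (AdeleRing (𝓞 E) E)ˣ)) : AdeleRing (𝓞 E) E)).2 v) *
              Valued.v ((halfAdele : AdeleRing (𝓞 E) E).2 v) := by ac_rfl
      _ ≤ idealRadius E v 𝔫 := hval v
  · -- the `(1,0)` entry vanishes
    rw [coe_adelicVal_apply_of_not_lt_two w i j hlt, if_neg hne]
    change Valued.v (0 : v.adicCompletion E) ≤ _
    rw [Valuation.map_zero]
    exact zero_le

/-- **Both halves of `hval` on `β⁻¹ n(𝓕⁻) β`, for an ARBITRARY level `𝔫`**: the conjugate condition at `v` for `𝔫` is the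
plain condition at `c⁻¹ v` for `c⁻¹ • 𝔫` (`|c(e)_v| = |e_{c⁻¹ v}|`, ★ `valued_galAdicCompletionMap`; `|c⁻¹ • 𝔫|_{c⁻¹ v} = |𝔫|_v`,
★ `idealRadius_smul`), so ONE inequality per place for `𝔫` AND for `c⁻¹ • 𝔫` gives the `hval` premise of ★
`exists_isCompact_forall_oneFactor_two`. [cite: Rogawski1990, §2.2 (p. 13)] [cite: CasselsFrohlichANT1967, Ch. VII §1.1] -/
theorem hval_of_mem_borelConj_image_two (hc : c * c = 1) (β b : borelAdelic F E c 2) (𝔫 : Ideal (𝓞 E))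
    (hval : ∀ v : HeightOneSpectrum (𝓞 E),
      Valued.v ((((((diagUnit β.2 0)⁻¹ * diagUnit β.2 1 : (AdeleRing (𝓞 E) E)ˣ)) : AdeleRing (𝓞 E) E)).2 v) *
        Valued.v ((((((diagUnit b.2 0)⁻¹ * diagUnit b.2 1 : (AdeleRing (𝓞 E) E)ˣ)) : AdeleRing (𝓞 E) E)).2 v) *
          Valued.v ((halfAdele : AdeleRing (𝓞 E) E).2 v) ≤ idealRadius E v 𝔫)
    (hval' : ∀ v : HeightOneSpectrum (𝓞 E),
      Valued.v ((((((diagUnit β.2 0)⁻¹ * diagUnit β.2 1 : (AdeleRing (𝓞 E) E)ˣ)) : AdeleRing (𝓞 E) E)).2 v) *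
        Valued.v ((((((diagUnit b.2 0)⁻¹ * diagUnit b.2 1 : (AdeleRing (𝓞 E) E)ˣ)) : AdeleRing (𝓞 E) E)).2 v) *
          Valued.v ((halfAdele : AdeleRing (𝓞 E) E).2 v) ≤ idealRadius E v (c⁻¹ • 𝔫))
    {u : ↥(adelicUnipotent F E c 2)}
    (hu : u ∈ (fun v : ↥(adelicUnipotent F E c 2) => (⟨(β : (quasiSplit F E c 2).Adelic)⁻¹ * (v : (quasiSplit F E c 2).Adelic) *
        (β : (quasiSplit F E c 2).Adelic), conj_mem_adelicUnipotent β.2 v.2⟩ : ↥(adelicUnipotent F E c 2))) ''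
        ((fun y : ↥(traceZeroAdele F E c) => middleRootUnipotent hij hN (Multiplicative.ofAdd y)) ''
          traceZeroFundamentalDomain F E c)) :
    ∀ i j : Fin 2, i ≠ j → ∀ v : HeightOneSpectrum (𝓞 E),
      Valued.v ((((adelicVal F E c 2 _ ((b : (quasiSplit F E c 2).Adelic)⁻¹ * (u : (quasiSplit F E c 2).Adelic) *
          (b : (quasiSplit F E c 2).Adelic)) : GL (Fin 2) (AdeleRing (𝓞 E) E)) : Matrix (Fin 2) (Fin 2) (AdeleRing (𝓞 E) E)) i j).2 v) ≤
        idealRadius E v 𝔫 ∧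
      Valued.v ((conjAdele F E c (((adelicVal F E c 2 _ ((b : (quasiSplit F E c 2).Adelic)⁻¹ * (u : (quasiSplit F E c 2).Adelic) *
          (b : (quasiSplit F E c 2).Adelic)) : GL (Fin 2) (AdeleRing (𝓞 E) E)) : Matrix (Fin 2) (Fin 2) (AdeleRing (𝓞 E) E)) i j)).2 v) ≤
        idealRadius E v 𝔫 := by
  intro i j hne v
  refine ⟨forall_valued_entry_le_of_mem_borelConj_image_two hij hN hc β b 𝔫 hval hu i j hne v, ?_⟩
  rw [conjAdele_apply, AdeleRing.smul_snd, FiniteAdeleRing.smul_apply, valued_galAdicCompletionMap,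
    ← idealRadius_smul (F := F) c⁻¹ v 𝔫]
  exact forall_valued_entry_le_of_mem_borelConj_image_two hij hN hc β b (c⁻¹ • 𝔫) hval' hu i j hne (c⁻¹ • v)

/-! ## §3 The one-factor normal form on the dilated domain -/

/-- **THE ONE-FACTOR NORMAL FORM ON `β⁻¹ n(𝓕⁻) β` (consumer socket of the `N = 2` geometry row).** For `β ∈ B(𝔸_F)` there
are a compact set of directions `S` and `C ≥ 0` such that for all `b ∈ B(𝔸_F)`, all `k` with `π k ∈ K_∞ · GL₂(𝒪̂_E)`, every
level `𝔫` with `|d₀⁻¹d₁(β)|_v |d₀⁻¹d₁(b)|_v |½|_v ≤ |𝔫|_v` and `≤ |c⁻¹ • 𝔫|_v` at every finite place, and every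
`u ∈ β⁻¹ n(𝓕⁻) β`: `π((bk)⁻¹ u (bk)) = ι∞(expGL(t • X)) · w` with `X ∈ S`, `w ∈ K(𝔫)`, `|t| ≤ C · ‖(d₀⁻¹d₁(b))_∞‖` (★
`exists_isCompact_forall_oneFactor_two` at the compact superset of §1, fed by §2). [cite: Rogawski1990, §2.2 (p. 13)] -/
theorem exists_isCompact_forall_oneFactor_dilated_two (hc : c * c = 1) (β : borelAdelic F E c 2) :
    ∃ S : Set (Matrix (Fin 2) (Fin 2) (mixedSpace E)), IsCompact S ∧ ∃ C : ℝ, 0 ≤ C ∧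
      ∀ (b : borelAdelic F E c 2) (k : (quasiSplit F E c 2).Adelic),
        adelicVal F E c 2 _ k ∈ standardMaximalCompactGL 2 E →
        ∀ 𝔫 : Ideal (𝓞 E),
          (∀ v : HeightOneSpectrum (𝓞 E),
            Valued.v ((((((diagUnit β.2 0)⁻¹ * diagUnit β.2 1 : (AdeleRing (𝓞 E) E)ˣ)) : AdeleRing (𝓞 E) E)).2 v) *
              Valued.v ((((((diagUnit b.2 0)⁻¹ * diagUnit b.2 1 : (AdeleRing (𝓞 E) E)ˣ)) : AdeleRing (𝓞 E) E)).2 v) *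
                Valued.v ((halfAdele : AdeleRing (𝓞 E) E).2 v) ≤ idealRadius E v 𝔫) →
          (∀ v : HeightOneSpectrum (𝓞 E),
            Valued.v ((((((diagUnit β.2 0)⁻¹ * diagUnit β.2 1 : (AdeleRing (𝓞 E) E)ˣ)) : AdeleRing (𝓞 E) E)).2 v) *
              Valued.v ((((((diagUnit b.2 0)⁻¹ * diagUnit b.2 1 : (AdeleRing (𝓞 E) E)ˣ)) : AdeleRing (𝓞 E) E)).2 v) *
                Valued.v ((halfAdele : AdeleRing (𝓞 E) E).2 v) ≤ idealRadius E v (c⁻¹ • 𝔫)) →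
          ∀ u ∈ (fun v : ↥(adelicUnipotent F E c 2) => (⟨(β : (quasiSplit F E c 2).Adelic)⁻¹ * (v : (quasiSplit F E c 2).Adelic) *
              (β : (quasiSplit F E c 2).Adelic), conj_mem_adelicUnipotent β.2 v.2⟩ : ↥(adelicUnipotent F E c 2))) ''
              ((fun y : ↥(traceZeroAdele F E c) => middleRootUnipotent hij hN (Multiplicative.ofAdd y)) ''
                traceZeroFundamentalDomain F E c),
            ∃ (t : ℝ) (X : Matrix (Fin 2) (Fin 2) (mixedSpace E)) (w : GL (Fin 2) (AdeleRing (𝓞 E) E)),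
              X ∈ S ∧ w ∈ principalCongruenceLevel 2 E 𝔫 ∧
              |t| ≤ C * ‖archHom E ((((diagUnit b.2 0)⁻¹ * diagUnit b.2 1 : (AdeleRing (𝓞 E) E)ˣ)) : AdeleRing (𝓞 E) E)‖ ∧
              adelicVal F E c 2 _ (((b : (quasiSplit F E c 2).Adelic) * k)⁻¹ * (u : (quasiSplit F E c 2).Adelic) *
                  ((b : (quasiSplit F E c 2).Adelic) * k)) =
                GLn.ofInfinite 2 E (expGL (t • X)) * w := by
  obtain ⟨KN, hKN, hsub⟩ := exists_isCompact_borelConj_lineDomain_subset_two (F := F) (E := E) (c := c) hij hN hc β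
  obtain ⟨S, hS, C, hC0, hmain⟩ := exists_isCompact_forall_oneFactor_two (F := F) (E := E) (c := c) hKN
  refine ⟨S, hS, C, hC0, fun b k hk 𝔫 hval hval' u hu => ?_⟩
  exact hmain b k hk 𝔫 u (hsub hu) (hval_of_mem_borelConj_image_two hij hN hc β b 𝔫 hval hval' hu)

end UnitaryGroup

end Literature.NumberTheory.Automorphic

end
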